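import Summits.QuantumFields.YangMills.Theorems.BalabanUVNodesN15CovariantTwoGridStaircaseDefectEntries
import Summits.QuantumFields.YangMills.Theorems.BalabanUVNodesN15PerCubeGreenTwoGridKnitDefectSummand
import Summits.QuantumFields.YangMills.Theorems.BalabanUVNodesN15BackgroundAveragingWords
import HarnessLib

/-!
# N15 = NE2, road (c) — PROGRAMME (PC) «[B9] Sect. C FOR THE LANDAU LETTER WITH PER-CUBE GAUGES (3.35) AS PRINTED», (PC-E) (C6-d3) STEP 4: THE TWO-GRID η-DEFECT OF THE CUT GRAM
# PERTURBATION — n15-c∕340's displayed row `hDNV` PRODUCED: `𝔇_{(P̂,P̂)}(M_ψ′N′_VM_χ′, M_ψN_VM_χ) ≤ o_N·e^{−δdist}` with `o_N = |ι|(|a_K′ − a_K|(1+|ι|) + |a_K|·2|ι|κΘ) = O(L^{−2k} + ηq + ηp)`,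
# under King's covariant pairing, from the cube-gauge letters on the plateau blocks (dag-n15-c g32, n15-c∕352)

Cell `pub-ymgap`, seat `pub-ymgap-dag-n15-c` (generation g32; R134 (a) seat, strategy s1 «first missing estimate»; HUMAN RULING D-0062; chair R424 venue).
`bears_on: R4∕N15 · K3⁸ SpineGivenEndpointR13SepCoPHV (stmt-QuantumFields-27366)`; filed `--kind proof --supports stmt-QuantumFields-27366 --as helper` — COUNT-NEUTRAL.
THEOREMS only, 0 `def`, 0 `sorry`.  Imports BY NAME n15-c∕351 `cvaStair_kingPr_eq_corner` ∕ `abs_cvaStair_sub_corner_entry_le` ∕ `abs_gramEntry_sub_le` ∕ `abs_gramEntry_le`, n15-c∕341 `gauged_lineHol_eq_mprod`,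
n15-c `scNV_eq` ∕ `scNV'_eq` ∕ `csavg_transpose_mul_csavg_apply` ∕ `cvaStair_one` ∕ `abs_cvaStair_cvT_le_one`, `sum_fibre_comp` (`…BackgroundAveragingWords`), `card_fibre_kingProj`, `blockOf_kingPr`,
`scPsi'_eq_scPsi_kingPr` ∕ `scChi'_eq_scChi_kingPr`, `scBlk_mem_cvSk_of_scPsi_ne_zero`, B11 `loc_ofBlocks_le` ∕ `abs_le_loc_ofBlocks`.  Nothing in the tree is modified, no landed name re-declared.

WHY.  `N_V = a(Q₁ᵀQ₁ − Q_TᵀQ_T)` is block-diagonal with entries `a n^{−2(d+1)} Σ_l(δ_{li}δ_{lj} − T(Γ_{y,x})_{li}T(Γ_{y,z})_{lj})` (n15-c `csavg_transpose_mul_csavg_apply`); acting on `(χf)∘π` on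
the fine grid and on `χf` on the coarse grid, and grouping the fine block by the fibres of `π` (`(L^r)^{d+1}` points each, weights `a′n′^{−2(d+1)}(L^r)^{d+1} = a_K′ n^{−(d+1)}` against
`a n^{−2(d+1)} = a_K n^{−(d+1)}`), the defect at `(x′, i)` is `ψ(πx′)·n^{−(d+1)}(L^r)^{−(d+1)}Σ_z Σ_{z′∈π⁻¹z} Σ_j (a_K′S′(x′,z′) − a_K S^⌞(x′,z′))_{ij}·χ(z)f(z,j)`, where — by
the PAIRING OF STAIRCASES (n15-c∕350∕351 `cvaStair_kingPr_eq_corner`) — the coarse Gram entry `S(πx′, z)` IS the fine Gram entry `S^⌞(x′, z′)` of the transports to the cell CORNERS;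
n15-c∕351 bounds `|S′ − S^⌞| ≤ 2|ι|κΘ` (two staircases in one cell, n15-c∕349) and `|S′| ≤ 1 + |ι|`, whence `|defect| ≤ |ι|·(|a_K′ − a_K|(1+|ι|) + |a_K|2|ι|κΘ)·‖f‖_{B(y)}`;
block-diagonality gives the kernel `o_N e^{−δ·0}` and `0` off the diagonal.

HONEST FRAMING ∕ LIMITS.  MODEL two-grid setting (coarse field = straight fine holonomy); the letters `ρ`, `b` of the cube-gauged fine field on the plateau blocks are INPUTS (n15-c∕346∕348
produce them from one `Reg335Cube` per cube); nothing of [B7]∕[B9] asserted ((3.19) p.393, (3.57)–(3.60) pp.401–402, (3.63)–(3.65) pp.402–403 = SHAPES∕mechanism).  NE2⁺ NOT PRINTED, NOT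
proved; N15 of record untouched (DISCHARGED AS CONSUMED, p687738); K3⁸ OPEN; counts of record UNMOVED (typed 28∕28 · discharged 8∕27); one finite 𝕋⁴ at fixed ε per index — NOT infinite
volume, NOT OS on ℝ⁴, NOT a mass gap, NOT Clay.  Restate-immune (no Theses import).
-/

set_option autoImplicit false

noncomputable section

open scoped BigOperators Matrix Matrix.Norms.L2Operator
open Finset

namespace Summit.QuantumFields.YangMills.BalabanUVNodes.N15.Gluing

open Real
open Literature.MathematicalPhysics.QuantumFieldTheory.Balaban1983to89
open Literature.MathematicalPhysics.QuantumFieldTheory.Balaban1983to89.B5Prop11Plancherel (Tor fine unitVec)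
open Literature.MathematicalPhysics.QuantumFieldTheory.Balaban1983to89.B11SectG (BlockNorm HasMaj)
open Literature.MathematicalPhysics.QuantumFieldTheory.Balaban1983to89.B11AxialTransport190 (loc_ofBlocks_le abs_le_loc_ofBlocks)
open Literature.MathematicalPhysics.QuantumFieldTheory.Balaban1983to89.T4EtaRateDefect (idef)
open Literature.MathematicalPhysics.QuantumFieldTheory.Balaban1983to89.T4EtaRateCoeffDefect (pull pull_apply fibre mem_fibre)
open Literature.MathematicalPhysics.QuantumFieldTheory.Balaban1983to89.B6Prop26Gluing (mulOp mulOp_apply)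
open Literature.MathematicalPhysics.QuantumFieldTheory.Balaban1983to89.B6UnitTorusCarrier (unitTorusGeo)
open Literature.MathematicalPhysics.QuantumFieldTheory.King1986 (aK)
open Literature.MathematicalPhysics.QuantumFieldTheory.King1986.Torus (blockOf tdistT_self)
open Literature.Barriers.QuantumFields (traceForm)
open Summit.QuantumFields.YangMills.BalabanUVNodes.N15.VectorPiece (kingPr kingPr_val blockCoords)
open Summit.QuantumFields.YangMills.BalabanUVNodes.N15.MatrixSpecies (coordMat basisConst basisConst_nonneg liftBlk liftMap)
open Summit.QuantumFields.YangMills.BalabanUVNodes.N15.DefectKernel (card_fibre_kingProj)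
open Summit.QuantumFields.YangMills.BalabanUVNodes.N15.TwoGrid (abs_chiCube_le_one)
open Summit.QuantumFields.YangMills.BalabanUVNodes.N15.BackgroundLayer (sum_fibre_comp)
open Summit.QuantumFields.YangMills.BalabanUVNodes.N15.CovLandau (csavg csavg_transpose_mul_csavg_apply)
open Summit.QuantumFields.YangMills.BalabanUVNodes.N15.CovAvg (mprod kingSec cvaStair cvaStair_one blockOf_kingPr gauged_lineHol_eq_mprod cvaStair_kingPr_eq_corner abs_cvaStair_sub_corner_entry_le
  abs_gramEntry_sub_le abs_gramEntry_le)

variable {d : ℕ}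

/-! ## §1 The block-diagonal Gram operator applied, in fibre form -/

section Apply

variable (M : Fin (d + 1) → ℕ) [∀ μ, NeZero (M μ)] {ι : Type} [Fintype ι] [DecidableEq ι]

/-- ★ `(a·(Q₁ᵀQ₁ − Q_TᵀQ_T)h)(x, i) = a·n^{−2(d+1)}·Σ_{z ∈ B(x)} Σ_j [Σ_l(δ_{li}δ_{lj} − T(Γ_{y,x})_{li}T(Γ_{y,z})_{lj})]·h(z, j)` (`y = B(x)`): the block-diagonal Gram operator read as a sum over the
block of the argument. [cite: Balaban1985BackgroundPropagators, (3.19) p.393, (3.59)–(3.60) p.402 (shapes)] -/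
theorem csavgSq_sub_mulVecLin_apply (nn : ℕ) [NeZero nn] (a : ℝ) (T : Fin (d + 1) → Tor (fine nn M) → Matrix ι ι ℝ) (h : Tor (fine nn M) × ι → ℝ) (p : Tor (fine nn M) × ι) :
    Matrix.mulVecLin (a • (((csavg M nn (fun (_ : Fin (d + 1)) (_ : Tor (fine nn M)) => (1 : Matrix ι ι ℝ)))ᵀ * csavg M nn (fun (_ : Fin (d + 1)) (_ : Tor (fine nn M)) => (1 : Matrix ι ι ℝ))) -
        ((csavg M nn T)ᵀ * csavg M nn T))) h p =
      a * ((((nn : ℝ)) ^ (d + 1))⁻¹ * (((nn : ℝ)) ^ (d + 1))⁻¹) * ∑ z ∈ fibre (blockOf nn M) (blockOf nn M p.1), ∑ j,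
        (∑ l, ((1 : Matrix ι ι ℝ) l p.2 * (1 : Matrix ι ι ℝ) l j - cvaStair M nn (fun μ b => T μ b.1) (blockOf nn M p.1) (blockCoords nn M p.1).2 0 l p.2 *
          cvaStair M nn (fun μ b => T μ b.1) (blockOf nn M p.1) (blockCoords nn M z).2 0 l j)) * h (z, j) := by
  classical
  rw [Matrix.mulVecLin_apply, Matrix.mulVec, dotProduct]
  have hent : ∀ q : Tor (fine nn M) × ι, (a • (((csavg M nn (fun (_ : Fin (d + 1)) (_ : Tor (fine nn M)) => (1 : Matrix ι ι ℝ)))ᵀ * csavg M nn (fun (_ : Fin (d + 1)) (_ : Tor (fine nn M)) => (1 : Matrix ι ι ℝ))) -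
        ((csavg M nn T)ᵀ * csavg M nn T))) p q * h q =
      if blockOf nn M q.1 = blockOf nn M p.1 then a * ((((nn : ℝ)) ^ (d + 1))⁻¹ * (((nn : ℝ)) ^ (d + 1))⁻¹) *
        ((∑ l, ((1 : Matrix ι ι ℝ) l p.2 * (1 : Matrix ι ι ℝ) l q.2 - cvaStair M nn (fun μ b => T μ b.1) (blockOf nn M p.1) (blockCoords nn M p.1).2 0 l p.2 *
          cvaStair M nn (fun μ b => T μ b.1) (blockOf nn M p.1) (blockCoords nn M q.1).2 0 l q.2)) * h q) else 0 := by
    intro q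
    rw [Matrix.smul_apply, Matrix.sub_apply, csavg_transpose_mul_csavg_apply, csavg_transpose_mul_csavg_apply]
    by_cases hb : blockOf nn M q.1 = blockOf nn M p.1
    · rw [if_pos hb, if_pos hb, if_pos hb]
      simp only [cvaStair_one, smul_eq_mul]
      rw [← mul_sub, ← Finset.sum_sub_distrib]; ring
    · simp only [if_neg hb, sub_zero, smul_zero, zero_mul]
  rw [Finset.sum_congr rfl fun q _ => hent q, ← Finset.sum_filter]
  have hset : Finset.univ.filter (fun q : Tor (fine nn M) × ι => blockOf nn M q.1 = blockOf nn M p.1) = fibre (blockOf nn M) (blockOf nn M p.1) ×ˢ (Finset.univ : Finset ι) := by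
    ext q
    simp only [Finset.mem_filter, Finset.mem_univ, true_and, Finset.mem_product, and_true, mem_fibre]
  rw [hset, Finset.sum_product]
  simp only [Finset.mul_sum]

end Apply


/-! ## §1b The defect of the Gram sums across King's pairing (abstract transports) -/

section Generic

variable (M : Fin (d + 1) → ℕ) [∀ μ, NeZero (M μ)] (L kk r : ℕ) [NeZero L] {ι : Type} [Fintype ι] [DecidableEq ι]

set_option maxHeartbeats 800000 in
/-- ★★ **THE GRAM SUMS ACROSS THE PAIRING** (abstract transports): if the fine staircase transports have entries `≤ 1`, differ entrywise by `≤ θ` from the transports to the cell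
corners, and the coarse transports at `π`-images ARE the fine transports to the corners, then the fine Gram sum over the block (weights `α′n′^{−(d+1)}`, argument `(χf)∘π`) and the
coarse one (weights `αn^{−2(d+1)}`, argument `χf`) differ by `≤ |ι|(|α′ − α|(1+|ι|) + |α|2|ι|θ)·B` whenever `|χ| ≤ 1` and `|f| ≤ B` on the block. [cite: Balaban1985BackgroundPropagators,
(3.63)–(3.65) pp.402–403 (mechanism: shape); King1986, p.664 (pairing convention)] -/
theorem abs_gramDefect_le (Tf : Fin (d + 1) → Tor (fine (L ^ r * L ^ kk) M) × Fin (d + 1) → Matrix ι ι ℝ) (Tc : Fin (d + 1) → Tor (fine (L ^ kk) M) × Fin (d + 1) → Matrix ι ι ℝ)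
    (y : Tor M) {θ B : ℝ} (α α' : ℝ) (hθ : 0 ≤ θ)
    (h1 : ∀ a l j, |cvaStair M (L ^ r * L ^ kk) Tf y a 0 l j| ≤ 1)
    (hcrn : ∀ w' : Tor (fine (L ^ r * L ^ kk) M), blockOf (L ^ r * L ^ kk) M w' = y → ∀ l j, |(cvaStair M (L ^ r * L ^ kk) Tf y (blockCoords (L ^ r * L ^ kk) M w').2 0 - cvaStair M (L ^ r * L ^ kk) Tf y (fun i => (⟨L ^ r * ((((blockCoords (L ^ r * L ^ kk) M w').2 i : Fin (L ^ r * L ^ kk)) : ℕ) / L ^ r), (Nat.mul_div_le _ _).trans_lt ((blockCoords (L ^ r * L ^ kk) M w').2 i).isLt⟩ : Fin (L ^ r * L ^ kk))) 0) l j| ≤ θ)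
    (hpair : ∀ w' : Tor (fine (L ^ r * L ^ kk) M), blockOf (L ^ r * L ^ kk) M w' = y → cvaStair M (L ^ kk) Tc y (blockCoords (L ^ kk) M (kingPr L kk r M w')).2 0 = cvaStair M (L ^ r * L ^ kk) Tf y (fun i => (⟨L ^ r * ((((blockCoords (L ^ r * L ^ kk) M w').2 i : Fin (L ^ r * L ^ kk)) : ℕ) / L ^ r), (Nat.mul_div_le _ _).trans_lt ((blockCoords (L ^ r * L ^ kk) M w').2 i).isLt⟩ : Fin (L ^ r * L ^ kk))) 0)
    (χ : Tor (fine (L ^ kk) M) → ℝ) (hχ : ∀ z, |χ z| ≤ 1) (f : Tor (fine (L ^ kk) M) × ι → ℝ) (hf : ∀ z j, blockOf (L ^ kk) M z = y → |f (z, j)| ≤ B)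
    (x' : Tor (fine (L ^ r * L ^ kk) M)) (hx' : blockOf (L ^ r * L ^ kk) M x' = y) (i : ι) :
    |α' * ((((L ^ r * L ^ kk : ℕ) : ℝ)) ^ (d + 1))⁻¹ * ∑ z' ∈ fibre (blockOf (L ^ r * L ^ kk) M) y, ∑ j, (∑ l, ((1 : Matrix ι ι ℝ) l i * (1 : Matrix ι ι ℝ) l j - cvaStair M (L ^ r * L ^ kk) Tf y (blockCoords (L ^ r * L ^ kk) M x').2 0 l i * cvaStair M (L ^ r * L ^ kk) Tf y (blockCoords (L ^ r * L ^ kk) M z').2 0 l j)) * (χ (kingPr L kk r M z') * f (kingPr L kk r M z', j)) -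
      α * ((((L ^ kk : ℕ) : ℝ)) ^ (d + 1))⁻¹ * ∑ z ∈ fibre (blockOf (L ^ kk) M) y, ∑ j, (∑ l, ((1 : Matrix ι ι ℝ) l i * (1 : Matrix ι ι ℝ) l j - cvaStair M (L ^ kk) Tc y (blockCoords (L ^ kk) M (kingPr L kk r M x')).2 0 l i * cvaStair M (L ^ kk) Tc y (blockCoords (L ^ kk) M z).2 0 l j)) * (χ z * f (z, j))| ≤ Fintype.card ι * (|α' - α| * (1 + Fintype.card ι) + |α| * (2 * Fintype.card ι * θ)) * B := by
  classical
  have hLr : 0 < L ^ r := pow_pos (Nat.pos_of_ne_zero (NeZero.ne L)) r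
  have hn0 : (0 : ℝ) < (((L ^ kk : ℕ) : ℝ)) := by exact_mod_cast pow_pos (Nat.pos_of_ne_zero (NeZero.ne L)) kk
  have hR0 : (0 : ℝ) < (((L ^ r : ℕ) : ℝ)) := by exact_mod_cast hLr
  have hE0 : 0 ≤ (|α' - α| * (1 + Fintype.card ι) + |α| * (2 * Fintype.card ι * θ)) := by positivity
  -- constants: `n′^{−(d+1)} = n^{−(d+1)}·(L^r)^{−(d+1)}`
  have hcc : ((((L ^ r * L ^ kk : ℕ) : ℝ)) ^ (d + 1))⁻¹ = ((((L ^ kk : ℕ) : ℝ)) ^ (d + 1))⁻¹ * ((((L ^ r : ℕ) : ℝ)) ^ (d + 1))⁻¹ := by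
    rw [Nat.cast_mul, mul_pow, mul_inv, mul_comm]
  -- blocks of fibre points
  have hblkz : ∀ z ∈ fibre (blockOf (L ^ kk) M) y, blockOf (L ^ kk) M z = y := fun z hz => (mem_fibre _ _ _).1 hz
  have hblkz' : ∀ z ∈ fibre (blockOf (L ^ kk) M) y, ∀ z' ∈ fibre (kingPr L kk r M) z, blockOf (L ^ r * L ^ kk) M z' = y := fun z hz z' hz' => by
    rw [← blockOf_kingPr, (mem_fibre _ _ _).1 hz']; exact hblkz z hz
  -- (s1)+(s2): the fine block summed fibre by fibre
  have hfib : fibre (blockOf (L ^ r * L ^ kk) M) y = fibre (blockOf (L ^ kk) M ∘ kingPr L kk r M) y := by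
    ext w; simp only [mem_fibre, Function.comp_apply, blockOf_kingPr]
  have hfine : ∑ z' ∈ fibre (blockOf (L ^ r * L ^ kk) M) y, ∑ j, (∑ l, ((1 : Matrix ι ι ℝ) l i * (1 : Matrix ι ι ℝ) l j - cvaStair M (L ^ r * L ^ kk) Tf y (blockCoords (L ^ r * L ^ kk) M x').2 0 l i * cvaStair M (L ^ r * L ^ kk) Tf y (blockCoords (L ^ r * L ^ kk) M z').2 0 l j)) * (χ (kingPr L kk r M z') * f (kingPr L kk r M z', j)) =
      ∑ z ∈ fibre (blockOf (L ^ kk) M) y, ∑ z' ∈ fibre (kingPr L kk r M) z, ∑ j, (∑ l, ((1 : Matrix ι ι ℝ) l i * (1 : Matrix ι ι ℝ) l j - cvaStair M (L ^ r * L ^ kk) Tf y (blockCoords (L ^ r * L ^ kk) M x').2 0 l i * cvaStair M (L ^ r * L ^ kk) Tf y (blockCoords (L ^ r * L ^ kk) M z').2 0 l j)) * (χ z * f (z, j)) := by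
    rw [hfib, sum_fibre_comp]
    refine Finset.sum_congr rfl fun z hz => Finset.sum_congr rfl fun z' hz' => ?_
    rw [(mem_fibre _ _ _).1 hz']
  -- (s3): the coarse block sum, written over the fibres with the CORNER transports
  have hcoarse : ∑ z ∈ fibre (blockOf (L ^ kk) M) y, ∑ j, (∑ l, ((1 : Matrix ι ι ℝ) l i * (1 : Matrix ι ι ℝ) l j - cvaStair M (L ^ kk) Tc y (blockCoords (L ^ kk) M (kingPr L kk r M x')).2 0 l i * cvaStair M (L ^ kk) Tc y (blockCoords (L ^ kk) M z).2 0 l j)) * (χ z * f (z, j)) =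
      ∑ z ∈ fibre (blockOf (L ^ kk) M) y, ∑ z' ∈ fibre (kingPr L kk r M) z, ∑ j, ((((L ^ r : ℕ) : ℝ)) ^ (d + 1))⁻¹ * ((∑ l, ((1 : Matrix ι ι ℝ) l i * (1 : Matrix ι ι ℝ) l j - cvaStair M (L ^ r * L ^ kk) Tf y (fun i => (⟨L ^ r * ((((blockCoords (L ^ r * L ^ kk) M x').2 i : Fin (L ^ r * L ^ kk)) : ℕ) / L ^ r), (Nat.mul_div_le _ _).trans_lt ((blockCoords (L ^ r * L ^ kk) M x').2 i).isLt⟩ : Fin (L ^ r * L ^ kk))) 0 l i * cvaStair M (L ^ r * L ^ kk) Tf y (fun i => (⟨L ^ r * ((((blockCoords (L ^ r * L ^ kk) M z').2 i : Fin (L ^ r * L ^ kk)) : ℕ) / L ^ r), (Nat.mul_div_le _ _).trans_lt ((blockCoords (L ^ r * L ^ kk) M z').2 i).isLt⟩ : Fin (L ^ r * L ^ kk))) 0 l j)) * (χ z * f (z, j))) := by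
    refine Finset.sum_congr rfl fun z hz => ?_
    have hin : ∀ z' ∈ fibre (kingPr L kk r M) z, ∑ j, ((((L ^ r : ℕ) : ℝ)) ^ (d + 1))⁻¹ * ((∑ l, ((1 : Matrix ι ι ℝ) l i * (1 : Matrix ι ι ℝ) l j - cvaStair M (L ^ r * L ^ kk) Tf y (fun i => (⟨L ^ r * ((((blockCoords (L ^ r * L ^ kk) M x').2 i : Fin (L ^ r * L ^ kk)) : ℕ) / L ^ r), (Nat.mul_div_le _ _).trans_lt ((blockCoords (L ^ r * L ^ kk) M x').2 i).isLt⟩ : Fin (L ^ r * L ^ kk))) 0 l i * cvaStair M (L ^ r * L ^ kk) Tf y (fun i => (⟨L ^ r * ((((blockCoords (L ^ r * L ^ kk) M z').2 i : Fin (L ^ r * L ^ kk)) : ℕ) / L ^ r), (Nat.mul_div_le _ _).trans_lt ((blockCoords (L ^ r * L ^ kk) M z').2 i).isLt⟩ : Fin (L ^ r * L ^ kk))) 0 l j)) * (χ z * f (z, j))) =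
        ∑ j, ((((L ^ r : ℕ) : ℝ)) ^ (d + 1))⁻¹ * ((∑ l, ((1 : Matrix ι ι ℝ) l i * (1 : Matrix ι ι ℝ) l j - cvaStair M (L ^ kk) Tc y (blockCoords (L ^ kk) M (kingPr L kk r M x')).2 0 l i * cvaStair M (L ^ kk) Tc y (blockCoords (L ^ kk) M z).2 0 l j)) * (χ z * f (z, j))) := by
      intro z' hz'
      have e1 := hpair x' hx'
      have e2 := hpair z' (hblkz' z hz z' hz')
      rw [(mem_fibre _ _ _).1 hz'] at e2
      rw [e1, e2]
    rw [Finset.sum_congr rfl hin, Finset.sum_const, card_fibre_kingProj L kk r M (kingPr L kk r M) (kingPr_val L kk r M) z, nsmul_eq_mul, Finset.mul_sum]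
    refine Finset.sum_congr rfl fun j _ => ?_
    rw [Nat.cast_pow, mul_inv_cancel_left₀ (pow_ne_zero _ hR0.ne')]
  -- termwise bound
  have hterm : ∀ z ∈ fibre (blockOf (L ^ kk) M) y, ∀ z' ∈ fibre (kingPr L kk r M) z, ∀ j,
      |α' * ((((L ^ r * L ^ kk : ℕ) : ℝ)) ^ (d + 1))⁻¹ * ((∑ l, ((1 : Matrix ι ι ℝ) l i * (1 : Matrix ι ι ℝ) l j - cvaStair M (L ^ r * L ^ kk) Tf y (blockCoords (L ^ r * L ^ kk) M x').2 0 l i * cvaStair M (L ^ r * L ^ kk) Tf y (blockCoords (L ^ r * L ^ kk) M z').2 0 l j)) * (χ z * f (z, j))) -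
        α * ((((L ^ kk : ℕ) : ℝ)) ^ (d + 1))⁻¹ * (((((L ^ r : ℕ) : ℝ)) ^ (d + 1))⁻¹ * ((∑ l, ((1 : Matrix ι ι ℝ) l i * (1 : Matrix ι ι ℝ) l j - cvaStair M (L ^ r * L ^ kk) Tf y (fun i => (⟨L ^ r * ((((blockCoords (L ^ r * L ^ kk) M x').2 i : Fin (L ^ r * L ^ kk)) : ℕ) / L ^ r), (Nat.mul_div_le _ _).trans_lt ((blockCoords (L ^ r * L ^ kk) M x').2 i).isLt⟩ : Fin (L ^ r * L ^ kk))) 0 l i * cvaStair M (L ^ r * L ^ kk) Tf y (fun i => (⟨L ^ r * ((((blockCoords (L ^ r * L ^ kk) M z').2 i : Fin (L ^ r * L ^ kk)) : ℕ) / L ^ r), (Nat.mul_div_le _ _).trans_lt ((blockCoords (L ^ r * L ^ kk) M z').2 i).isLt⟩ : Fin (L ^ r * L ^ kk))) 0 l j)) * (χ z * f (z, j))))| ≤ ((((L ^ r * L ^ kk : ℕ) : ℝ)) ^ (d + 1))⁻¹ * ((|α' - α| * (1 + Fintype.card ι) + |α| * (2 * Fintype.card ι * θ)) * B) := by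
    intro z hz z' hz' j
    have hz'y := hblkz' z hz z' hz'
    have hS : |(∑ l, ((1 : Matrix ι ι ℝ) l i * (1 : Matrix ι ι ℝ) l j - cvaStair M (L ^ r * L ^ kk) Tf y (blockCoords (L ^ r * L ^ kk) M x').2 0 l i * cvaStair M (L ^ r * L ^ kk) Tf y (blockCoords (L ^ r * L ^ kk) M z').2 0 l j))| ≤ 1 + Fintype.card ι := abs_gramEntry_le (fun l i => h1 _ l i) (fun l j => h1 _ l j) i j
    have hD : |(∑ l, ((1 : Matrix ι ι ℝ) l i * (1 : Matrix ι ι ℝ) l j - cvaStair M (L ^ r * L ^ kk) Tf y (blockCoords (L ^ r * L ^ kk) M x').2 0 l i * cvaStair M (L ^ r * L ^ kk) Tf y (blockCoords (L ^ r * L ^ kk) M z').2 0 l j)) - (∑ l, ((1 : Matrix ι ι ℝ) l i * (1 : Matrix ι ι ℝ) l j - cvaStair M (L ^ r * L ^ kk) Tf y (fun i => (⟨L ^ r * ((((blockCoords (L ^ r * L ^ kk) M x').2 i : Fin (L ^ r * L ^ kk)) : ℕ) / L ^ r), (Nat.mul_div_le _ _).trans_lt ((blockCoords (L ^ r * L ^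 kk) M x').2 i).isLt⟩ : Fin (L ^ r * L ^ kk))) 0 l i * cvaStair M (L ^ r * L ^ kk) Tf y (fun i => (⟨L ^ r * ((((blockCoords (L ^ r * L ^ kk) M z').2 i : Fin (L ^ r * L ^ kk)) : ℕ) / L ^ r), (Nat.mul_div_le _ _).trans_lt ((blockCoords (L ^ r * L ^ kk) M z').2 i).isLt⟩ : Fin (L ^ r * L ^ kk))) 0 l j))| ≤ 2 * Fintype.card ι * θ :=
      abs_gramEntry_sub_le hθ (fun l i => h1 _ l i) (fun l j => h1 _ l j) (fun l i => hcrn x' hx' l i) (fun l j => hcrn z' hz'y l j) i j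
    have hχf : |χ z * f (z, j)| ≤ B := by rw [abs_mul]; exact (mul_le_mul (hχ z) (hf z j (hblkz z hz)) (abs_nonneg _) zero_le_one).trans (by rw [one_mul])
    have e : α' * ((((L ^ r * L ^ kk : ℕ) : ℝ)) ^ (d + 1))⁻¹ * ((∑ l, ((1 : Matrix ι ι ℝ) l i * (1 : Matrix ι ι ℝ) l j - cvaStair M (L ^ r * L ^ kk) Tf y (blockCoords (L ^ r * L ^ kk) M x').2 0 l i * cvaStair M (L ^ r * L ^ kk) Tf y (blockCoords (L ^ r * L ^ kk) M z').2 0 l j)) * (χ z * f (z, j))) -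
        α * ((((L ^ kk : ℕ) : ℝ)) ^ (d + 1))⁻¹ * (((((L ^ r : ℕ) : ℝ)) ^ (d + 1))⁻¹ * ((∑ l, ((1 : Matrix ι ι ℝ) l i * (1 : Matrix ι ι ℝ) l j - cvaStair M (L ^ r * L ^ kk) Tf y (fun i => (⟨L ^ r * ((((blockCoords (L ^ r * L ^ kk) M x').2 i : Fin (L ^ r * L ^ kk)) : ℕ) / L ^ r), (Nat.mul_div_le _ _).trans_lt ((blockCoords (L ^ r * L ^ kk) M x').2 i).isLt⟩ : Fin (L ^ r * L ^ kk))) 0 l i * cvaStair M (L ^ r * L ^ kk) Tf y (fun i => (⟨L ^ r * ((((blockCoords (L ^ r * L ^ kk) M z').2 i : Fin (L ^ r * L ^ kk)) : ℕ) / L ^ r), (Nat.mul_div_le _ _).trans_lt ((blockCoords (L ^ r * L ^ kk) M z').2 i).isLt⟩ : Fin (L ^ r * L ^ kk))) 0 l j)) * (χ z * f (z, j)))) =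
        ((((L ^ r * L ^ kk : ℕ) : ℝ)) ^ (d + 1))⁻¹ * (((α' - α) * (∑ l, ((1 : Matrix ι ι ℝ) l i * (1 : Matrix ι ι ℝ) l j - cvaStair M (L ^ r * L ^ kk) Tf y (blockCoords (L ^ r * L ^ kk) M x').2 0 l i * cvaStair M (L ^ r * L ^ kk) Tf y (blockCoords (L ^ r * L ^ kk) M z').2 0 l j)) + α * ((∑ l, ((1 : Matrix ι ι ℝ) l i * (1 : Matrix ι ι ℝ) l j - cvaStair M (L ^ r * L ^ kk) Tf y (blockCoords (L ^ r * L ^ kk) M x').2 0 l i * cvaStair M (L ^ r * L ^ kk) Tf y (blockCoords (L ^ r * L ^ kk) M z').2 0 l j)) - (∑ l, ((1 : Matrix ι ι ℝ) l i * (1 : Matrix ι ι ℝ) l j - cvaStair M (L ^ r * L ^ kk) Tf y (fun i => (⟨L ^ r * ((((blockCoords (L ^ r * L ^ kk) M x').2 i : Fin (L ^ r * L ^ kk)) : ℕ) / L ^ r), (Nat.mul_div_le _ _).trans_lt ((blockCoords (L ^ r * L ^ kk) M x').2 i).isLt⟩ : Fin (L ^ r * L ^ kk))) 0 l i * cvaStair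 M (L ^ r * L ^ kk) Tf y (fun i => (⟨L ^ r * ((((blockCoords (L ^ r * L ^ kk) M z').2 i : Fin (L ^ r * L ^ kk)) : ℕ) / L ^ r), (Nat.mul_div_le _ _).trans_lt ((blockCoords (L ^ r * L ^ kk) M z').2 i).isLt⟩ : Fin (L ^ r * L ^ kk))) 0 l j)))) * (χ z * f (z, j))) := by
      rw [hcc]; ring
    rw [e, abs_mul, abs_of_pos (by rw [hcc]; positivity), abs_mul]
    refine mul_le_mul_of_nonneg_left (mul_le_mul ((abs_add_le _ _).trans (add_le_add ?_ ?_)) hχf (abs_nonneg _) hE0) (by rw [hcc]; positivity)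
    · rw [abs_mul]; exact mul_le_mul_of_nonneg_left hS (abs_nonneg _)
    · rw [abs_mul]; exact mul_le_mul_of_nonneg_left hD (abs_nonneg _)
  -- assemble
  rw [hfine, hcoarse, Finset.mul_sum, Finset.mul_sum, ← Finset.sum_sub_distrib]
  refine (Finset.abs_sum_le_sum_abs _ _).trans ?_
  calc ∑ z ∈ fibre (blockOf (L ^ kk) M) y, |α' * ((((L ^ r * L ^ kk : ℕ) : ℝ)) ^ (d + 1))⁻¹ * ∑ z' ∈ fibre (kingPr L kk r M) z, ∑ j, (∑ l, ((1 : Matrix ι ι ℝ) l i * (1 : Matrix ι ι ℝ) l j - cvaStair M (L ^ r * L ^ kk) Tf y (blockCoords (L ^ r * L ^ kk) M x').2 0 l i * cvaStair M (L ^ r * L ^ kk) Tf y (blockCoords (L ^ r * L ^ kk) M z').2 0 l j)) * (χ z * f (z, j)) -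
          α * ((((L ^ kk : ℕ) : ℝ)) ^ (d + 1))⁻¹ * ∑ z' ∈ fibre (kingPr L kk r M) z, ∑ j, ((((L ^ r : ℕ) : ℝ)) ^ (d + 1))⁻¹ * ((∑ l, ((1 : Matrix ι ι ℝ) l i * (1 : Matrix ι ι ℝ) l j - cvaStair M (L ^ r * L ^ kk) Tf y (fun i => (⟨L ^ r * ((((blockCoords (L ^ r * L ^ kk) M x').2 i : Fin (L ^ r * L ^ kk)) : ℕ) / L ^ r), (Nat.mul_div_le _ _).trans_lt ((blockCoords (L ^ r * L ^ kk) M x').2 i).isLt⟩ : Fin (L ^ r * L ^ kk))) 0 l i * cvaStair M (L ^ r * L ^ kk) Tf y (fun i => (⟨L ^ r * ((((blockCoords (L ^ r * L ^ kk) M z').2 i : Fin (L ^ r * L ^ kk)) : ℕ) / L ^ r), (Nat.mul_div_le _ _).trans_lt ((blockCoords (L ^ r * L ^ kk) M z').2 i).isLt⟩ : Fin (L ^ r * L ^ kk))) 0 l j)) * (χ z * f (z, j)))|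
      ≤ ∑ z ∈ fibre (blockOf (L ^ kk) M) y, ∑ z' ∈ fibre (kingPr L kk r M) z, ∑ _j : ι, ((((L ^ r * L ^ kk : ℕ) : ℝ)) ^ (d + 1))⁻¹ * ((|α' - α| * (1 + Fintype.card ι) + |α| * (2 * Fintype.card ι * θ)) * B) := by
        refine Finset.sum_le_sum fun z hz => ?_
        rw [Finset.mul_sum, Finset.mul_sum, ← Finset.sum_sub_distrib]
        refine (Finset.abs_sum_le_sum_abs _ _).trans (Finset.sum_le_sum fun z' hz' => ?_)
        rw [Finset.mul_sum, Finset.mul_sum, ← Finset.sum_sub_distrib]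
        exact (Finset.abs_sum_le_sum_abs _ _).trans (Finset.sum_le_sum fun j _ => hterm z hz z' hz' j)
    _ = Fintype.card ι * (|α' - α| * (1 + Fintype.card ι) + |α| * (2 * Fintype.card ι * θ)) * B := by
        simp only [Finset.sum_const, Finset.card_univ, nsmul_eq_mul]
        rw [Finset.sum_congr rfl fun z _ => by rw [card_fibre_kingProj L kk r M (kingPr L kk r M) (kingPr_val L kk r M) z], Finset.sum_const,
          CovLandau.card_fibre_blockOf_fine, nsmul_eq_mul, hcc]
        have hL0 : (L : ℝ) ≠ 0 := by exact_mod_cast (NeZero.ne L)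
        push_cast
        field_simp

end Generic

/-! ## §2 The two-grid defect of the cut Gram perturbation -/

section Defect

variable {L : ℕ} [NeZero L] {mv kk r : ℕ} {hL : Odd L ∧ 1 < L} {mm : Type} [Fintype mm] [DecidableEq mm] (ι : Type) [Fintype ι] [DecidableEq ι] (e : Matrix mm mm ℂ ≃L[ℝ] (ι → ℝ))

set_option maxHeartbeats 1600000 in
/-- ★★★ **n15-c∕340's `hDNV` PRODUCED UNDER THE COVARIANT PAIRING**: for unitary cube gauges `u′_k`, a unitary fine bond field `U′`, the coarse field `U_μ = Π_{t<L^r}U′_μ(σ· + te′_μ)`,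
and the letters `‖V′ − 1‖ ≤ ρ`, `‖V′_μ(z + e′_κ) − V′_μ(z)‖ ≤ b` of the gauged fine field `V′ = u′_kU′u′_k(·+e′)ᴴ` at the fine sites of the plateau blocks `𝔅_k`: the two-grid η-defect of the
cut Gram perturbations `M_ψ′_kN′_VM_χ′_k` (fine, gauge `u′_k`) against `M_ψ_kN_VM_χ_k` (coarse, induced gauge `u′_k∘σ`) through `(P̂, P̂)` is `≤ o_N·e^{−δ|y−y′|}` for every `δ`, with
`o_N = |ι|(|a_K′ − a_K|(1 + |ι|) + |a_K|·2|ι|·κ_e2√|m|√|m|·(d+1)(d·n′L^rb + (1+ρ)^{L^r} − 1))` (`a_K = aK a₀ L k`, `a_K′ = aK a₀ L (r+k)`).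
[cite: Balaban1985BackgroundPropagators, (3.19) p.393, (3.57)–(3.60) pp.401–402, (3.63)–(3.65) pp.402–403 (shapes∕mechanism); King1986, p.664 (pairing convention)] -/
theorem hasMaj_idef_scNV_pairing (he : ∀ A B : Matrix mm mm ℂ, traceForm A B = e A ⬝ᵥ e B) (a₀ : ℝ)
    (u' : (Fin (d + 1) → ZMod (2 * L)) → ScX' d L mv kk r hL → Matrix mm mm ℂ) (hu' : ∀ k z, (u' k z)ᴴ * u' k z = 1)
    (U' : Fin (d + 1) → ScX' d L mv kk r hL → Matrix mm mm ℂ) (hU' : ∀ μ z, (U' μ z)ᴴ * U' μ z = 1) (U : Fin (d + 1) → ScX d L mv kk hL → Matrix mm mm ℂ)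
    (hpair : ∀ μ y, U μ y = mprod (fun t => U' μ (kingSec (cvM d L mv kk hL) L kk r y + t • unitVec (fine (L ^ r * L ^ kk) (cvM d L mv kk hL)) μ)) (L ^ r))
    {ρ b : ℝ} (hρ : 0 ≤ ρ) (hb : 0 ≤ b)
    (hρk : ∀ k μ (z : ScX' d L mv kk r hL), scBlk' d L mv kk r hL z ∈ cvSk d L mv kk hL k → ‖u' k z * U' μ z * (u' k (scShift' d L mv kk r hL μ z))ᴴ - 1‖ ≤ ρ)
    (hbk : ∀ k κ μ (z : ScX' d L mv kk r hL), scBlk' d L mv kk r hL z ∈ cvSk d L mv kk hL k →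
      ‖u' k (z + unitVec (fine (L ^ r * L ^ kk) (cvM d L mv kk hL)) κ) * U' μ (z + unitVec (fine (L ^ r * L ^ kk) (cvM d L mv kk hL)) κ) * (u' k ((z + unitVec (fine (L ^ r * L ^ kk) (cvM d L mv kk hL)) κ) + unitVec (fine (L ^ r * L ^ kk) (cvM d L mv kk hL)) μ))ᴴ - (u' k z * U' μ z * (u' k (z + unitVec (fine (L ^ r * L ^ kk) (cvM d L mv kk hL)) μ))ᴴ)‖ ≤ b)
    (δ : ℝ) (k : Fin (d + 1) → ZMod (2 * L)) :
    HasMaj (ScNorm d L mv kk hL ι) (BlockNorm.ofBlocks (unitTorusGeo L kk (cvM d L mv kk hL)) (liftBlk (scBlk d L mv kk hL ∘ kingPr L kk r (cvM d L mv kk hL)) ι))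
      (idef (pull (liftMap (kingPr L kk r (cvM d L mv kk hL)) ι)) (pull (liftMap (kingPr L kk r (cvM d L mv kk hL)) ι)) (mulOp (fun p : ScX' d L mv kk r hL × ι => scPsi' d L mv kk r hL k p.1) ∘ₗ (scNV' d L mv kk r hL (aK a₀ (L : ℝ) (r + kk) * (((L ^ r * L ^ kk : ℕ) : ℝ)) ^ (d + 1)) ι e u' U' k) ∘ₗ mulOp (fun p : ScX' d L mv kk r hL × ι => scChi' d L mv kk r hL k p.1)) (mulOp (fun p : ScX d L mv kk hL × ι => scPsi d L mv kk hL k p.1) ∘ₗ (scNV d L mv kk hL (aK a₀ (L : ℝ) kk * (((L ^ kk : ℕ) : ℝ)) ^ (d + 1)) ι e (fun k x => u' k (kingSec (cvM d L mv kk hL) L kk r x)) U k) ∘ₗ mulOp (fun p : ScX d L mv kk hL × ι => scChi d L mv kk hL k p.1)))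
      (fun y y' => (Fintype.card ι * (|aK a₀ (L : ℝ) (r + kk) - aK a₀ (L : ℝ) kk| * (1 + Fintype.card ι) + |aK a₀ (L : ℝ) kk| * (2 * Fintype.card ι * (@basisConst ι _ (Matrix mm mm ℂ) Matrix.frobeniusNormedAddCommGroup Matrix.frobeniusNormedSpace e * (2 * Real.sqrt (Fintype.card mm)) * (Real.sqrt (Fintype.card mm) * ((d + 1) * (d * ((((L ^ r * L ^ kk : ℕ) : ℝ)) * (((L ^ r : ℕ) : ℝ) * b)) + ((1 + ρ) ^ (L ^ r) - 1)))))))) * Real.exp (-(δ * (unitTorusGeo L kk (cvM d L mv kk hL)).dist y y'))) := by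
  classical
  -- names
  set n' : ℕ := L ^ r * L ^ kk with hn'
  have hLr : 0 < L ^ r := pow_pos (Nat.pos_of_ne_zero (NeZero.ne L)) r
  have hn0 : (0 : ℝ) < (((L ^ kk : ℕ) : ℝ)) := by exact_mod_cast pow_pos (Nat.pos_of_ne_zero (NeZero.ne L)) kk
  have hn'0 : (0 : ℝ) < (((L ^ r * L ^ kk : ℕ) : ℝ)) := by exact_mod_cast Nat.pos_of_ne_zero (NeZero.ne _)
  rw [scNV'_eq ι e he _ hu' U' k, scNV_eq ι e he _ (fun k x => hu' k _) U k]
  set V' : Fin (d + 1) → ScX' d L mv kk r hL → Matrix mm mm ℂ := scGaugeU' d L mv kk r hL (u' k) U' with hV'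
  have hV'u : ∀ μ z, (V' μ z)ᴴ * V' μ z = 1 := fun μ z => CurvedSpecies.uN_gaugeTransformed_bond_unitary (scShift' d L mv kk r hL) (u' k) U' (hu' k) hU' μ z
  -- the coarse gauged field is the line holonomy of `V′` (n15-c∕341)
  have hVc : scGaugeU d L mv kk hL (fun x => u' k (kingSec (cvM d L mv kk hL) L kk r x)) U = fun μ x => mprod (fun t => V' μ (kingSec (cvM d L mv kk hL) L kk r x + t • unitVec (fine (L ^ r * L ^ kk) (cvM d L mv kk hL)) μ)) (L ^ r) := by
    funext μ x
    show u' k (kingSec (cvM d L mv kk hL) L kk r x) * U μ x * (u' k (kingSec (cvM d L mv kk hL) L kk r (scShift d L mv kk hL μ x)))ᴴ = _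
    rw [hpair μ x]
    exact gauged_lineHol_eq_mprod (cvM d L mv kk hL) L kk r (hu' k) U' μ x
  rw [hVc]
  -- the entry letters of the fine transports
  have h1 : ∀ y a l j, |cvaStair (cvM d L mv kk hL) (L ^ r * L ^ kk) (fun μ (b : ScX' d L mv kk r hL × Fin (d + 1)) => cvT e V' μ b.1) y a 0 l j| ≤ 1 := fun y a l j => abs_cvaStair_cvT_le_one (cvM d L mv kk hL) (L ^ r * L ^ kk) e he hV'u y a 0 l j
  have hpairS : ∀ (y : Tor (cvM d L mv kk hL)) (w' : ScX' d L mv kk r hL), blockOf (L ^ r * L ^ kk) (cvM d L mv kk hL) w' = y →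
      cvaStair (cvM d L mv kk hL) (L ^ kk) (fun μ (b : ScX d L mv kk hL × Fin (d + 1)) => cvT e (fun μ x => mprod (fun t => V' μ (kingSec (cvM d L mv kk hL) L kk r x + t • unitVec (fine (L ^ r * L ^ kk) (cvM d L mv kk hL)) μ)) (L ^ r)) μ b.1) y (blockCoords (L ^ kk) (cvM d L mv kk hL) (kingPr L kk r (cvM d L mv kk hL) w')).2 0 = cvaStair (cvM d L mv kk hL) (L ^ r * L ^ kk) (fun μ (b : ScX' d L mv kk r hL × Fin (d + 1)) => cvT e V' μ b.1) y (fun i => (⟨L ^ r * ((((blockCoords (L ^ r * L ^ kk) (cvM d L mv kk hL) w').2 i : Fin (L ^ r * L ^ kk)) : ℕ) / L ^ r), (Nat.mul_div_le _ _).trans_lt ((blockCoords (L ^ r * L ^ kk) (cvM d L mv kk hL) w').2 i).isLt⟩ : Fin (L ^ r * L ^ kk))) 0 := by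
    intro y w' hw'
    have h := cvaStair_kingPr_eq_corner (cvM d L mv kk hL) L kk r e V' w' 0
    rw [CovAvg.blockOf_kingPr (L := L) (k := kk) (m := r) (M := cvM d L mv kk hL) w', hw'] at h
    exact h
  -- on a plateau block the letters of `V′` hold, hence the corner bound (n15-c∕351)
  have hcrnS : ∀ (y : Tor (cvM d L mv kk hL)), y ∈ cvSk d L mv kk hL k → ∀ w' : ScX' d L mv kk r hL, blockOf (L ^ r * L ^ kk) (cvM d L mv kk hL) w' = y → ∀ l j,
      |(cvaStair (cvM d L mv kk hL) (L ^ r * L ^ kk) (fun μ (b : ScX' d L mv kk r hL × Fin (d + 1)) => cvT e V' μ b.1) y (blockCoords (L ^ r * L ^ kk) (cvM d L mv kk hL) w').2 0 - cvaStair (cvM d L mv kk hL) (L ^ r * L ^ kk) (fun μ (b : ScX' d L mv kk r hL × Fin (d + 1)) => cvT e V' μ b.1) y (fun i => (⟨L ^ r * ((((blockCoords (L ^ r * L ^ kk) (cvM d L mv kk hL) w').2 i : Fin (L ^ r * L ^ kk)) : ℕ) / L ^ r), (Nat.mul_div_le _ _).trans_lt ((blockCoords (L ^ r * L ^ kk)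 (cvM d L mv kk hL) w').2 i).isLt⟩ : Fin (L ^ r * L ^ kk))) 0) l j| ≤ (@basisConst ι _ (Matrix mm mm ℂ) Matrix.frobeniusNormedAddCommGroup Matrix.frobeniusNormedSpace e * (2 * Real.sqrt (Fintype.card mm)) * (Real.sqrt (Fintype.card mm) * ((d + 1) * (d * ((((L ^ r * L ^ kk : ℕ) : ℝ)) * (((L ^ r : ℕ) : ℝ) * b)) + ((1 + ρ) ^ (L ^ r) - 1))))) := by
    intro y hy w' hw' l j
    have hρy : ∀ μ (z : ScX' d L mv kk r hL), blockOf (L ^ r * L ^ kk) (cvM d L mv kk hL) z = y → ‖V' μ z - 1‖ ≤ ρ := fun μ z hz => hρk k μ z (by rw [show scBlk' d L mv kk r hL z = y from hz]; exact hy)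
    have hby : ∀ κ μ (z : ScX' d L mv kk r hL), blockOf (L ^ r * L ^ kk) (cvM d L mv kk hL) z = y → ‖V' μ (z + unitVec (fine (L ^ r * L ^ kk) (cvM d L mv kk hL)) κ) - V' μ z‖ ≤ b := fun κ μ z hz => hbk k κ μ z (by rw [show scBlk' d L mv kk r hL z = y from hz]; exact hy)
    exact abs_cvaStair_sub_corner_entry_le (cvM d L mv kk hL) L kk r e V' hV'u hρ hb y hρy hby (blockCoords (L ^ r * L ^ kk) (cvM d L mv kk hL) w').2 0 l j
  have hKTH : 0 ≤ (@basisConst ι _ (Matrix mm mm ℂ) Matrix.frobeniusNormedAddCommGroup Matrix.frobeniusNormedSpace e * (2 * Real.sqrt (Fintype.card mm)) * (Real.sqrt (Fintype.card mm) * ((d + 1) * (d * ((((L ^ r * L ^ kk : ℕ) : ℝ)) * (((L ^ r : ℕ) : ℝ) * b)) + ((1 + ρ) ^ (L ^ r) - 1))))) := by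
    have hE : 0 ≤ (1 + ρ) ^ (L ^ r) - 1 := by have := one_le_pow₀ (M₀ := ℝ) (a := 1 + ρ) (by linarith) (n := L ^ r); linarith
    have := @basisConst_nonneg ι _ (Matrix mm mm ℂ) Matrix.frobeniusNormedAddCommGroup Matrix.frobeniusNormedSpace e
    positivity
  have hA1 : (aK a₀ (L : ℝ) (r + kk) * (((L ^ r * L ^ kk : ℕ) : ℝ)) ^ (d + 1)) * ((((((L ^ r * L ^ kk : ℕ) : ℝ)) ^ (d + 1))⁻¹) * (((((L ^ r * L ^ kk : ℕ) : ℝ)) ^ (d + 1))⁻¹)) = aK a₀ (L : ℝ) (r + kk) * (((((L ^ r * L ^ kk : ℕ) : ℝ)) ^ (d + 1))⁻¹) := by field_simp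
  have hA0 : (aK a₀ (L : ℝ) kk * (((L ^ kk : ℕ) : ℝ)) ^ (d + 1)) * ((((((L ^ kk : ℕ) : ℝ)) ^ (d + 1))⁻¹) * (((((L ^ kk : ℕ) : ℝ)) ^ (d + 1))⁻¹)) = aK a₀ (L : ℝ) kk * (((((L ^ kk : ℕ) : ℝ)) ^ (d + 1))⁻¹) := by field_simp
  intro y' f hf y
  -- the pointwise bound on the fine block over `y`, for any bound `B` of `f` on the coarse block `y`
  have hpt : ∀ B : ℝ, 0 ≤ B → (∀ (z : ScX d L mv kk hL) (j : ι), blockOf (L ^ kk) (cvM d L mv kk hL) z = y → |f (z, j)| ≤ B) →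
      ∀ p' : ScX' d L mv kk r hL × ι, liftBlk (scBlk d L mv kk hL ∘ kingPr L kk r (cvM d L mv kk hL)) ι p' = y →
      |(idef (pull (liftMap (kingPr L kk r (cvM d L mv kk hL)) ι)) (pull (liftMap (kingPr L kk r (cvM d L mv kk hL)) ι))
          (mulOp (fun p : ScX' d L mv kk r hL × ι => scPsi' d L mv kk r hL k p.1) ∘ₗ
            Matrix.mulVecLin ((aK a₀ (L : ℝ) (r + kk) * (((L ^ r * L ^ kk : ℕ) : ℝ)) ^ (d + 1)) • (((csavg (cvM d L mv kk hL) (L ^ r * L ^ kk) (fun (_ : Fin (d + 1)) (_ : ScX' d L mv kk r hL) => (1 : Matrix ι ι ℝ)))ᵀ *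
                csavg (cvM d L mv kk hL) (L ^ r * L ^ kk) (fun (_ : Fin (d + 1)) (_ : ScX' d L mv kk r hL) => (1 : Matrix ι ι ℝ))) -
              ((csavg (cvM d L mv kk hL) (L ^ r * L ^ kk) (cvT e V'))ᵀ * csavg (cvM d L mv kk hL) (L ^ r * L ^ kk) (cvT e V')))) ∘ₗ
            mulOp (fun p : ScX' d L mv kk r hL × ι => scChi' d L mv kk r hL k p.1))
          (mulOp (fun p : ScX d L mv kk hL × ι => scPsi d L mv kk hL k p.1) ∘ₗ
            Matrix.mulVecLin ((aK a₀ (L : ℝ) kk * (((L ^ kk : ℕ) : ℝ)) ^ (d + 1)) • (((csavg (cvM d L mv kk hL) (L ^ kk) (fun (_ : Fin (d + 1)) (_ : ScX d L mv kk hL) => (1 : Matrix ι ι ℝ)))ᵀ *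
                csavg (cvM d L mv kk hL) (L ^ kk) (fun (_ : Fin (d + 1)) (_ : ScX d L mv kk hL) => (1 : Matrix ι ι ℝ))) -
              ((csavg (cvM d L mv kk hL) (L ^ kk) (cvT e (fun μ x => mprod (fun t => V' μ (kingSec (cvM d L mv kk hL) L kk r x + t • unitVec (fine (L ^ r * L ^ kk) (cvM d L mv kk hL)) μ)) (L ^ r))))ᵀ *
                csavg (cvM d L mv kk hL) (L ^ kk) (cvT e (fun μ x => mprod (fun t => V' μ (kingSec (cvM d L mv kk hL) L kk r x + t • unitVec (fine (L ^ r * L ^ kk) (cvM d L mv kk hL)) μ)) (L ^ r)))))) ∘ₗ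
            mulOp (fun p : ScX d L mv kk hL × ι => scChi d L mv kk hL k p.1)) f) p'| ≤ (Fintype.card ι * (|aK a₀ (L : ℝ) (r + kk) - aK a₀ (L : ℝ) kk| * (1 + Fintype.card ι) + |aK a₀ (L : ℝ) kk| * (2 * Fintype.card ι * (@basisConst ι _ (Matrix mm mm ℂ) Matrix.frobeniusNormedAddCommGroup Matrix.frobeniusNormedSpace e * (2 * Real.sqrt (Fintype.card mm)) * (Real.sqrt (Fintype.card mm) * ((d + 1) * (d * ((((L ^ r * L ^ kk : ℕ) : ℝ)) * (((L ^ r : ℕ) : ℝ) * b)) + ((1 + ρ) ^ (L ^ r) - 1)))))))) * B := by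
    rintro B hB hfB ⟨x', i⟩ hp'
    have hbx : blockOf (L ^ kk) (cvM d L mv kk hL) (kingPr L kk r (cvM d L mv kk hL) x') = y := hp'
    have hbx' : blockOf (L ^ r * L ^ kk) (cvM d L mv kk hL) x' = y := by rw [← CovAvg.blockOf_kingPr (L := L) (k := kk) (m := r) (M := cvM d L mv kk hL) x']; exact hbx
    simp only [T4EtaRateDefect.idef_apply, Pi.sub_apply, LinearMap.comp_apply, mulOp_apply, pull_apply]
    rw [csavgSq_sub_mulVecLin_apply, csavgSq_sub_mulVecLin_apply]
    simp only [mulOp_apply, pull_apply, scPsi'_eq_scPsi_kingPr, scChi'_eq_scChi_kingPr]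
    rw [hbx', hbx, hA1, hA0, ← mul_sub, abs_mul]
    by_cases hψ : scPsi d L mv kk hL k (kingPr L kk r (cvM d L mv kk hL) x') = 0
    · rw [hψ, abs_zero, zero_mul]; positivity
    have hy : y ∈ cvSk d L mv kk hL k := by rw [← hbx]; exact scBlk_mem_cvSk_of_scPsi_ne_zero hψ
    refine (mul_le_of_le_one_left (abs_nonneg _) (abs_chiCube_le_one _ _)).trans ?_
    exact abs_gramDefect_le (cvM d L mv kk hL) L kk r (fun μ (b : ScX' d L mv kk r hL × Fin (d + 1)) => cvT e V' μ b.1) (fun μ (b : ScX d L mv kk hL × Fin (d + 1)) => cvT e (fun μ x => mprod (fun t => V' μ (kingSec (cvM d L mv kk hL) L kk r x + t • unitVec (fine (L ^ r * L ^ kk) (cvM d L mv kk hL)) μ)) (L ^ r)) μ b.1) y (aK a₀ (L : ℝ) kk) (aK a₀ (L : ℝ) (r + kk)) hKTH (h1 y) (hcrnS y hy) (hpairS y)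
      (fun z => scChi d L mv kk hL k z) (fun z => abs_chiCube_le_one _ _) f hfB x' hbx' i
  by_cases hy : y = y'
  · subst hy
    have hloc0 := (ScNorm d L mv kk hL ι).loc_nonneg y f
    refine (loc_ofBlocks_le (g := (unitTorusGeo L kk (cvM d L mv kk hL))) (liftBlk (scBlk d L mv kk hL ∘ kingPr L kk r (cvM d L mv kk hL)) ι) _ (by positivity)
      (hpt _ hloc0 (fun z j hz => abs_le_loc_ofBlocks (g := (unitTorusGeo L kk (cvM d L mv kk hL))) (liftBlk (scBlk d L mv kk hL) ι) f (x' := (z, j)) hz))).trans (le_of_eq ?_)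
    dsimp only
    rw [Literature.MathematicalPhysics.QuantumFieldTheory.King1986.Torus.tdistT_self, mul_zero, neg_zero, Real.exp_zero, mul_one]
  · have hf0 : ∀ (z : ScX d L mv kk hL) (j : ι), blockOf (L ^ kk) (cvM d L mv kk hL) z = y → |f (z, j)| ≤ 0 := fun z j hz => by
      rw [hf (z, j) (show liftBlk (scBlk d L mv kk hL) ι (z, j) ≠ y' from fun h => hy (hz.symm.trans h)), abs_zero]
    refine (loc_ofBlocks_le (g := (unitTorusGeo L kk (cvM d L mv kk hL))) (liftBlk (scBlk d L mv kk hL ∘ kingPr L kk r (cvM d L mv kk hL)) ι) _ le_rfl (fun p' hp' => ?_)).trans ?_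
    · have h := hpt 0 le_rfl hf0 p' hp'; rw [mul_zero] at h; exact h
    · dsimp only
      exact mul_nonneg (mul_nonneg (by positivity) (Real.exp_pos _).le) ((ScNorm d L mv kk hL ι).loc_nonneg y' f)

end Defect

end Summit.QuantumFields.YangMills.BalabanUVNodes.N15.Gluing

end
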